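import Summits.RiemannHypothesis.RiemannHypothesis.Theses.Fences

/-!
# Line `zero-chain` for crux `ClusterForcing` (stmt-RiemannHypothesis-14530) — the BC2 redirect

crux-strategist r1, 2026-08-17. `ClusterForcing` is DERIVED from its two children (route items,
Fences.lean rev ≥ 7):

* `stub_zeroChainStep` = item stmt-RiemannHypothesis-17850 `ZeroChainStep` (crux, rank 3): the
  ζ-side ONE-STEP statement — under short-prime-sum cancellation every zero at depth `d ≤ D` below a
  near-apex zero has a successor zero strictly above it within `a d + b (loglog T)²/log T`
  (suppliers: `TwoSidedPowerSum` + `LocalZeroPowerSum` + `StepFromInverse`, see line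
  `step-from-inverse`);
* `stub_chainCount` = item stmt-RiemannHypothesis-17856 `ChainCount` (support, provable now):
  `ZeroChainStep → ClusterForcing`, the ordinate-increasing chain iteration and count.

Composition = modus ponens (`trivial_seam`; the content is in `stub_chainCount`). The stubs are the
route decls BY NAME, so closing the items closes the stubs.
-/

namespace Summit.RiemannHypothesis.RiemannHypothesis.Cruxes.ClusterForcing.ZeroChain

open Summit.RiemannHypothesis.RiemannHypothesis.Theses.Fences

/-- stub 1 = route item stmt-RiemannHypothesis-17850 (crux). -/
theorem stub_zeroChainStep : ZeroChainStep := by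
  sorry

/-- stub 2 = route item stmt-RiemannHypothesis-17856 (support, provable now). -/
theorem stub_chainCount : ChainCount := by
  sorry

/-- The composition: the crux BY NAME from the two stubs. -/
theorem ClusterForcing_of : ZeroChainStep → ChainCount →
    Summit.RiemannHypothesis.RiemannHypothesis.Theses.Fences.ClusterForcing :=
  fun hstep hcount => hcount hstep

/-- Hence the crux (modulo the stubs). -/
theorem clusterForcing : Summit.RiemannHypothesis.RiemannHypothesis.Theses.Fences.ClusterForcing :=
  ClusterForcing_of stub_zeroChainStep stub_chainCount

end Summit.RiemannHypothesis.RiemannHypothesis.Cruxes.ClusterForcing.ZeroChain
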